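import Mathlib.Analysis.SpecificLimits.Basic
import Literature.Analysis.FluidPDE.HardSphereScattering
import HarnessLib

/-!
# Alexander's theorem and Liouville's theorem for hard spheres on the torus

Last layer of the proof of **Alexander's theorem on `T^d`**
(`Kinetic.HardSphereFlow.nonempty_torus`, `Literature.Analysis.FluidPDE.HardSphereDynamics`):
the two measure-theoretic facts of the reduction
`Kinetic.HardSphereFlow.nonempty_torus_of_construction` (`HardSphereFlowConstruction`) are
discharged, and the theorem is assembled:

* `Kinetic.Alexander.torusFlow_ae_good_holds` — **Alexander's theorem** (Alexander 1975;
  Gallagher–Saint-Raymond–Texier 2013 Prop. 4.1.1; Cercignani–Illner–Pulvirenti 1994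
  Thm. 4.2.1 with App. 4.A): the complement of the good set `Γ₀` of the collision-by-collision
  flow is Liouville-null;
* `Kinetic.Alexander.torusFlow_measurePreserving_holds` — **Liouville's theorem**: each `T^t`
  preserves the Liouville measure;
* `Kinetic.HardSphereFlow.nonempty_torus_holds` — for `0 < ε < 1/2` and every `N` the
  hard-sphere flow on `(T^d × ℝ^d)^N` exists.

The proof is GST 2013's (proof of Prop. 4.1.1, p. 19): fix a speed bound `V` (energy shell
`E ≤ V²/2`), a horizon `t` and `δ = t/(m+1)`; by `HardSphereShortTime` a datum outside a set of
volume `≤ C δ²` is short-time good (forward regular up to `δ`, with `Φ_δ = S_δ ∘ kick`), and by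
`HardSphereScattering` the flow over one window does not lose volume; iterating
(`iterGood m`: the datum and its images at times `δ, 2δ, …, mδ` are short-time good) the data
that fail to be forward regular up to `t` have volume `≤ (m+1) C δ² = C t²/(m+1) → 0`
(`volume_not_fwdGoodUpTo_eq_zero`), whence forward regularity almost everywhere; backward
regularity follows by the velocity flip (`measurePreserving_flipVel`), and the conventions at
time `0` fail only on contact sets (null). The same iteration gives
`vol {z ∈ Γ₀ ∩ {E ≤ V²/2} | T^t z ∈ B} ≤ vol B` for `t ≥ 0`; since `Γ₀ ∩ {E ≤ V²/2}` is
invariant of finite volume, the complement trick upgrades this to equality, exhausting in `V`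
gives invariance of `vol|_{Γ₀} = liouville` under `T^t`, `t ≥ 0`, and the group property on `Γ₀`
(`HardSphereFlowGroup`) transfers it to `t < 0`.

## Mathlib / Literature reuse

`Monotone.measure_iUnion`, `measure_iUnion_null`, `Measure.restrict_congr_set`, `ae_eq_set`,
`MeasurePreserving.measure_preimage`, `ge_of_tendsto`, `tendsto_const_div_atTop_nhds_zero_nat`,
`ENNReal.Tendsto.const_mul` are Mathlib's. Everything about the flow is from the previous layers
(`HardSphereFlowConstruction`, `…Orbits`, `…Group`, `…Measurable`, `…Restart`, `…ShortTime`,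
`…Scattering`, `HardSphereTorusMeasure`).

## References

* R. K. Alexander, *The infinite hard sphere system*, Ph.D. thesis, UC Berkeley (1975).
* I. Gallagher, L. Saint-Raymond, B. Texier, *From Newton to Boltzmann: hard spheres and
  short-range potentials*, EMS (2013), arXiv:1208.5753, §4.1, Prop. 4.1.1 and its proof,
  Lemma 4.1.2 (p. 19).
* C. Cercignani, R. Illner, M. Pulvirenti, *The Mathematical Theory of Dilute Gases*, Springer
  (1994), §4.2 (Thm. 4.2.1), App. 4.A pp. 107–111.
-/

open Set Filter Topology Function MeasureTheory Metric
open scoped ENNReal InnerProductSpace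

namespace Literature.Analysis.FluidPDE

noncomputable section

section Kinetic

namespace Alexander

variable {d : Type*} [Fintype d] {N : ℕ}

/-! ## Iterating the short-time analysis -/

section Iteration

variable {ε δ V : ℝ}

variable (N) in
/-- The data of the energy shell `E ≤ V²/2` that are short-time good (window `δ`, interaction
length `2Vδ`) together with their images under the flow at the times `δ, 2δ, …, mδ`
(GST 2013, proof of Prop. 4.1.1: the data surviving `m + 1` iterations). [cite: GST2013, proof of Prop. 4.1.1 p. 19] -/
def iterGood (ε δ V : ℝ) (m : ℕ) : Set (Config N d (UnitAddTorus d)) :=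
  {z | configEnergy z ≤ V ^ 2 / 2 ∧ z ∈ shortGood N ε (2 * V * δ) δ ∧
    ∀ k : ℕ, k < m → fwdFlow (Torus.geometry d) ε z (((k : ℝ) + 1) * δ) ∈ shortGood N ε (2 * V * δ) δ}

/-- `iterGood` decreases with the number of iterations. [folklore] -/
theorem iterGood_succ_subset (m : ℕ) : iterGood (d := d) N ε δ V (m + 1) ⊆ iterGood N ε δ V m :=
  fun _ hz => ⟨hz.1, hz.2.1, fun k hk => hz.2.2 k (Nat.lt_succ_of_lt hk)⟩

/-- **Regularity of the survivors**: a datum of `iterGood m` is forward regular up to time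
`(m+1)δ` (restart, `FwdGoodUpTo.add`, `m` times). [cite: GST2013, proof of Prop. 4.1.1 p. 19] -/
theorem fwdGoodUpTo_of_mem_iterGood (hε : 0 < ε) (hch : ε + 2 * (2 * V * δ) < 2⁻¹)
    (hV0 : 0 ≤ V) (hδ : 0 ≤ δ) (m : ℕ) {z : Config N d (UnitAddTorus d)}
    (hz : z ∈ iterGood N ε δ V m) :
    FwdGoodUpTo (Torus.geometry d) ε (((m : ℝ) + 1) * δ) z := by
  induction m generalizing z with
  | zero =>
    simp only [Nat.cast_zero, zero_add, one_mul]
    exact fwdGoodUpTo_of_mem_shortGood hε hch le_rfl hV0 hδ hz.1 hz.2.1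
  | succ m ih =>
    have hreg := ih (iterGood_succ_subset m hz)
    have hm0 : 0 ≤ ((m : ℝ) + 1) * δ := by positivity
    have hy : fwdFlow (Torus.geometry d) ε z (((m : ℝ) + 1) * δ) ∈ shortGood N ε (2 * V * δ) δ :=
      hz.2.2 m (Nat.lt_succ_self m)
    have hEy : configEnergy (fwdFlow (Torus.geometry d) ε z (((m : ℝ) + 1) * δ)) ≤ V ^ 2 / 2 := by
      rw [configEnergy_fwdFlow]; exact hz.1
    have hstep := hreg.add hm0 hδ (fwdGoodUpTo_of_mem_shortGood hε hch le_rfl hV0 hδ hEy hy)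
    have hcast : (((m + 1 : ℕ) : ℝ) + 1) * δ = ((m : ℝ) + 1) * δ + δ := by push_cast; ring
    rw [hcast]
    exact hstep.1

/-- **Restart of the survivors**: for a datum of `iterGood (m+1)` the flow at time
`(m+1)δ + δ` is the flow over one more window of its flow at time `(m+1)δ`. [folklore] -/
theorem fwdFlow_add_of_mem_iterGood (hε : 0 < ε) (hch : ε + 2 * (2 * V * δ) < 2⁻¹)
    (hV0 : 0 ≤ V) (hδ : 0 ≤ δ) (m : ℕ) {z : Config N d (UnitAddTorus d)}
    (hz : z ∈ iterGood N ε δ V (m + 1)) :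
    fwdFlow (Torus.geometry d) ε z (((m : ℝ) + 1) * δ + δ) =
      fwdFlow (Torus.geometry d) ε (fwdFlow (Torus.geometry d) ε z (((m : ℝ) + 1) * δ)) δ := by
  have hreg := fwdGoodUpTo_of_mem_iterGood hε hch hV0 hδ m (iterGood_succ_subset m hz)
  have hm0 : 0 ≤ ((m : ℝ) + 1) * δ := by positivity
  have hy : fwdFlow (Torus.geometry d) ε z (((m : ℝ) + 1) * δ) ∈ shortGood N ε (2 * V * δ) δ :=
    hz.2.2 m (Nat.lt_succ_self m)
  have hEy : configEnergy (fwdFlow (Torus.geometry d) ε z (((m : ℝ) + 1) * δ)) ≤ V ^ 2 / 2 := by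
    rw [configEnergy_fwdFlow]; exact hz.1
  exact (hreg.add hm0 hδ (fwdGoodUpTo_of_mem_shortGood hε hch le_rfl hV0 hδ hEy hy)).2

/-- **The survivors do not lose volume under the flow**: for measurable `B`,
`vol {z ∈ iterGood m | Φ_{(m+1)δ} z ∈ B} ≤ vol B` (induction on `m` with the one-window
estimate `volume_shortGood_inter_preimage_fwdFlow_le`). [cite: GST2013, proof of Prop. 4.1.1 p. 19] -/
theorem volume_iterGood_inter_preimage_le (hε : 0 < ε) (hch : ε + 2 * (2 * V * δ) < 2⁻¹)
    (hV0 : 0 ≤ V) (hδ : 0 ≤ δ) (m : ℕ) {B : Set (Config N d (UnitAddTorus d))}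
    (hB : MeasurableSet B) :
    volume {z | z ∈ iterGood N ε δ V m ∧ fwdFlow (Torus.geometry d) ε z (((m : ℝ) + 1) * δ) ∈ B} ≤
      volume B := by
  have hr0 : 0 ≤ 2 * V * δ := by positivity
  have hε' : ε < 2⁻¹ := by linarith
  have hG := Torus.isHardSphereRegular_geometry (d := d) hε'
  induction m generalizing B with
  | zero =>
    refine le_trans (measure_mono fun z hz => ?_)
      (volume_shortGood_inter_preimage_fwdFlow_le hε hch le_rfl hV0 hδ hB)
    simp only [Nat.cast_zero, zero_add, one_mul, mem_setOf_eq] at hz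
    exact ⟨hz.1.2.1, hz.1.1, hz.2⟩
  | succ m ih =>
    set B' : Set (Config N d (UnitAddTorus d)) := {y | y ∈ shortGood N ε (2 * V * δ) δ ∧
      configEnergy y ≤ V ^ 2 / 2 ∧ fwdFlow (Torus.geometry d) ε y δ ∈ B} with hB'
    have hB'm : MeasurableSet B' :=
      (measurableSet_shortGood ε _ δ).inter ((measurableSet_energyShell _).inter
        (measurable_fwdFlow hG Torus.isMeasurable_geometry δ hB))
    have hcast : (((m + 1 : ℕ) : ℝ) + 1) * δ = ((m : ℝ) + 1) * δ + δ := by push_cast; ring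
    calc volume {z | z ∈ iterGood N ε δ V (m + 1) ∧
          fwdFlow (Torus.geometry d) ε z ((((m + 1 : ℕ) : ℝ) + 1) * δ) ∈ B}
        ≤ volume {z | z ∈ iterGood N ε δ V m ∧
            fwdFlow (Torus.geometry d) ε z (((m : ℝ) + 1) * δ) ∈ B'} := by
          refine measure_mono fun z hz => ⟨iterGood_succ_subset m hz.1, ?_⟩
          have hflow := fwdFlow_add_of_mem_iterGood hε hch hV0 hδ m hz.1
          refine ⟨hz.1.2.2 m (Nat.lt_succ_self m), by rw [configEnergy_fwdFlow]; exact hz.1.1, ?_⟩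
          have h2 := hz.2
          rw [hcast, hflow] at h2
          exact h2
      _ ≤ volume B' := ih hB'm
      _ ≤ volume B := volume_shortGood_inter_preimage_fwdFlow_le hε hch le_rfl hV0 hδ hB

variable (N) in
/-- The bound for the volume lost in one window: `N⁴ (d · 2Vδ · vol B₁)² vol(B̄_V)^N`
(`HardSphereShortTime.volume_diff_shortGood_inter_velBall_le` with `r = 2Vδ`). [folklore] -/
def windowLoss (δ V : ℝ) : ℝ≥0∞ :=
  (N : ℝ≥0∞) ^ 4 * ((ENNReal.ofReal (Fintype.card d * (2 * V * δ)) *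
    volume (Metric.ball (0 : EuclideanSpace ℝ d) 1)) ^ 2 *
      volume (Metric.closedBall (0 : EuclideanSpace ℝ d) V) ^ N)

/-- The short-time bad part of the energy shell has volume at most `windowLoss`. [folklore] -/
theorem volume_shell_diff_shortGood_le (hε : 0 < ε) (hch : ε + 2 * (2 * V * δ) < 2⁻¹)
    (hV0 : 0 ≤ V) (hδ : 0 ≤ δ) :
    volume {z : Config N d (UnitAddTorus d) | z ∈ hardSphereDomain (Torus.geometry d) N ε ∧
      configEnergy z ≤ V ^ 2 / 2 ∧ z ∉ shortGood N ε (2 * V * δ) δ} ≤ windowLoss (d := d) N δ V := by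
  have hr0 : 0 ≤ 2 * V * δ := by positivity
  have h12 : ε + 2 * V * δ < 1 / 2 := by
    have : (2⁻¹ : ℝ) = 1 / 2 := by norm_num
    linarith
  refine le_trans (measure_mono fun z hz => ?_)
    (volume_diff_shortGood_inter_velBall_le hε hr0 h12 δ V)
  exact ⟨⟨hz.1, hz.2.2⟩, setOf_configEnergy_le_subset_velBall hV0 hz.2.1⟩

/-- **The volume lost in `m + 1` windows**: the data of the energy shell in the domain that
do not survive `m + 1` iterations have volume at most `(m + 1) · windowLoss`
(GST 2013, proof of Prop. 4.1.1: "the measure of initial data leading to a pathological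
trajectory on `[0, t]` is bounded by `C t δ`"). [cite: GST2013, proof of Prop. 4.1.1 p. 19] -/
theorem volume_shell_diff_iterGood_le (hε : 0 < ε) (hch : ε + 2 * (2 * V * δ) < 2⁻¹)
    (hV0 : 0 ≤ V) (hδ : 0 ≤ δ) (m : ℕ) :
    volume ({z : Config N d (UnitAddTorus d) | z ∈ hardSphereDomain (Torus.geometry d) N ε ∧
      configEnergy z ≤ V ^ 2 / 2} \ iterGood N ε δ V m) ≤ (m + 1) * windowLoss (d := d) N δ V := by
  induction m with
  | zero =>
    rw [Nat.cast_zero, zero_add, one_mul]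
    refine le_trans (measure_mono fun z hz => ?_) (volume_shell_diff_shortGood_le hε hch hV0 hδ)
    refine ⟨hz.1.1, hz.1.2, fun hsg => hz.2 ⟨hz.1.2, hsg, fun k hk => (Nat.not_lt_zero k hk).elim⟩⟩
  | succ m ih =>
    have hloss : volume (iterGood (d := d) N ε δ V m \ iterGood N ε δ V (m + 1)) ≤
        windowLoss (d := d) N δ V := by
      refine le_trans ?_ (volume_shell_diff_shortGood_le hε hch hV0 hδ)
      refine le_trans (measure_mono fun z hz => ?_)
        (volume_iterGood_inter_preimage_le hε hch hV0 hδ m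
          (((measurableSet_hardSphereDomain _ Torus.measurable_geometry_sepVec N ε).inter
            ((measurableSet_energyShell _).inter (measurableSet_shortGood ε _ δ).compl))))
      obtain ⟨hzm, hzn⟩ := hz
      have hreg := fwdGoodUpTo_of_mem_iterGood hε hch hV0 hδ m hzm
      have hm0 : 0 ≤ ((m : ℝ) + 1) * δ := by positivity
      refine ⟨hzm, hreg.fwdFlow_mem hm0 le_rfl, by rw [configEnergy_fwdFlow]; exact hzm.1, fun hsg => hzn ?_⟩
      exact ⟨hzm.1, hzm.2.1, fun k hk => by
        rcases Nat.lt_succ_iff_lt_or_eq.1 hk with hk | rfl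
        · exact hzm.2.2 k hk
        · exact hsg⟩
    calc volume ({z : Config N d (UnitAddTorus d) | z ∈ hardSphereDomain (Torus.geometry d) N ε ∧
            configEnergy z ≤ V ^ 2 / 2} \ iterGood N ε δ V (m + 1))
        ≤ volume (({z : Config N d (UnitAddTorus d) | z ∈ hardSphereDomain (Torus.geometry d) N ε ∧
            configEnergy z ≤ V ^ 2 / 2} \ iterGood N ε δ V m) ∪
              (iterGood N ε δ V m \ iterGood N ε δ V (m + 1))) := by
          refine measure_mono fun z hz => ?_
          by_cases hzm : z ∈ iterGood N ε δ V m
          · exact Or.inr ⟨hzm, hz.2⟩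
          · exact Or.inl ⟨hz.1, hzm⟩
      _ ≤ (m + 1) * windowLoss (d := d) N δ V + windowLoss (d := d) N δ V :=
          (measure_union_le _ _).trans (add_le_add ih hloss)
      _ = ((m + 1 : ℕ) + 1) * windowLoss (d := d) N δ V := by push_cast; ring

/-- The window loss as a multiple of `δ²`: `windowLoss δ V = K(V) · δ²` with
`K(V) = N⁴ (2dV vol B₁)² vol(B̄_V)^N < ∞`. [folklore] -/
theorem windowLoss_eq (hV0 : 0 ≤ V) (δ : ℝ) :
    windowLoss (d := d) N δ V = (N : ℝ≥0∞) ^ 4 * ((ENNReal.ofReal (Fintype.card d * (2 * V)) *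
      volume (Metric.ball (0 : EuclideanSpace ℝ d) 1)) ^ 2 *
        volume (Metric.closedBall (0 : EuclideanSpace ℝ d) V) ^ N) * ENNReal.ofReal δ ^ 2 := by
  rw [windowLoss]
  have : ENNReal.ofReal (Fintype.card d * (2 * V * δ)) =
      ENNReal.ofReal (Fintype.card d * (2 * V)) * ENNReal.ofReal δ := by
    rw [← ENNReal.ofReal_mul (by positivity)]; ring_nf
  rw [this]
  ring

/-- The constant `K(V)` is finite. [folklore] -/
theorem windowLoss_const_lt_top (V : ℝ) :
    (N : ℝ≥0∞) ^ 4 * ((ENNReal.ofReal (Fintype.card d * (2 * V)) *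
      volume (Metric.ball (0 : EuclideanSpace ℝ d) 1)) ^ 2 *
        volume (Metric.closedBall (0 : EuclideanSpace ℝ d) V) ^ N) < ∞ := by
  have h1 : volume (Metric.ball (0 : EuclideanSpace ℝ d) 1) < ∞ := measure_ball_lt_top
  have h2 : volume (Metric.closedBall (0 : EuclideanSpace ℝ d) V) < ∞ := measure_closedBall_lt_top
  refine ENNReal.mul_lt_top (ENNReal.pow_lt_top (ENNReal.natCast_lt_top N)) ?_
  refine ENNReal.mul_lt_top (ENNReal.pow_lt_top (ENNReal.mul_lt_top ENNReal.ofReal_lt_top h1)) ?_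
  exact ENNReal.pow_lt_top h2

/-- **The loss over a fixed horizon vanishes as the window shrinks**: with `δ = t/(m+1)`,
`(m + 1) · windowLoss (t/(m+1)) V → 0` as `m → ∞`. [folklore] -/
theorem tendsto_windowLoss (hV0 : 0 ≤ V) {t : ℝ} (ht : 0 ≤ t) :
    Tendsto (fun m : ℕ => ((m : ℝ≥0∞) + 1) * windowLoss (d := d) N (t / ((m : ℝ) + 1)) V)
      atTop (𝓝 0) := by
  set K : ℝ≥0∞ := (N : ℝ≥0∞) ^ 4 * ((ENNReal.ofReal (Fintype.card d * (2 * V)) *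
      volume (Metric.ball (0 : EuclideanSpace ℝ d) 1)) ^ 2 *
        volume (Metric.closedBall (0 : EuclideanSpace ℝ d) V) ^ N) with hK
  have hKtop : K ≠ ∞ := (windowLoss_const_lt_top V).ne
  have heq : ∀ m : ℕ, ((m : ℝ≥0∞) + 1) * windowLoss (d := d) N (t / ((m : ℝ) + 1)) V =
      K * ENNReal.ofReal (t ^ 2 / ((m : ℝ) + 1)) := by
    intro m
    have hm : (0 : ℝ) < (m : ℝ) + 1 := by positivity
    rw [windowLoss_eq hV0, ← hK]
    have h1 : ((m : ℝ≥0∞) + 1) = ENNReal.ofReal ((m : ℝ) + 1) := by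
      rw [ENNReal.ofReal_add (by positivity) zero_le_one, ENNReal.ofReal_natCast, ENNReal.ofReal_one]
    rw [h1, mul_comm (ENNReal.ofReal _) (K * _), mul_assoc, ← ENNReal.ofReal_pow (div_nonneg ht hm.le),
      ← ENNReal.ofReal_mul (by positivity)]
    congr 2
    field_simp
  simp_rw [heq]
  have hreal : Tendsto (fun m : ℕ => t ^ 2 / ((m : ℝ) + 1)) atTop (𝓝 0) := by
    have h := tendsto_const_div_atTop_nhds_zero_nat (t ^ 2)
    have h' : Tendsto (fun m : ℕ => t ^ 2 / ((m + 1 : ℕ) : ℝ)) atTop (𝓝 0) :=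
      h.comp (tendsto_add_atTop_nat 1)
    simpa using h'
  have h2 : Tendsto (fun m : ℕ => ENNReal.ofReal (t ^ 2 / ((m : ℝ) + 1))) atTop (𝓝 0) := by
    simpa using ENNReal.tendsto_ofReal hreal
  simpa using ENNReal.Tendsto.const_mul h2 (Or.inr hKtop)

/-- Eventually in `m`, the window `δ = t/(m+1)` satisfies the chart condition
`ε + 4V δ < 1/2`. [folklore] -/
theorem eventually_chart (hε' : ε < 2⁻¹) (V t : ℝ) :
    ∀ᶠ m : ℕ in atTop, ε + 2 * (2 * V * (t / ((m : ℝ) + 1))) < 2⁻¹ := by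
  have h : Tendsto (fun m : ℕ => 4 * V * t / ((m : ℝ) + 1)) atTop (𝓝 0) := by
    have h := tendsto_const_div_atTop_nhds_zero_nat (4 * V * t)
    have h' : Tendsto (fun m : ℕ => 4 * V * t / ((m + 1 : ℕ) : ℝ)) atTop (𝓝 0) :=
      h.comp (tendsto_add_atTop_nat 1)
    simpa using h'
  have hpos : (0 : ℝ) < 2⁻¹ - ε := by linarith
  filter_upwards [Filter.Tendsto.eventually_lt_const hpos h] with m hm
  have : 2 * (2 * V * (t / ((m : ℝ) + 1))) = 4 * V * t / ((m : ℝ) + 1) := by ring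
  linarith

/-! ## Alexander's theorem -/

/-- **Data of an energy shell that are not forward regular up to a fixed horizon are null**
(GST 2013 Prop. 4.1.1 for `t ∈ [0, T]`, forward in time). [cite: GST2013, Prop. 4.1.1 p. 19] -/
theorem volume_not_fwdGoodUpTo_eq_zero (hε : 0 < ε) (hε' : ε < 2⁻¹) (hV0 : 0 ≤ V) {t : ℝ}
    (ht : 0 < t) :
    volume {z : Config N d (UnitAddTorus d) | z ∈ hardSphereDomain (Torus.geometry d) N ε ∧
      configEnergy z ≤ V ^ 2 / 2 ∧ ¬ FwdGoodUpTo (Torus.geometry d) ε t z} = 0 := by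
  refine le_antisymm ?_ bot_le
  refine ge_of_tendsto (tendsto_windowLoss (d := d) (N := N) hV0 ht.le) ?_
  filter_upwards [eventually_chart hε' V t] with m hm
  have hδ : 0 ≤ t / ((m : ℝ) + 1) := by positivity
  have hT : ((m : ℝ) + 1) * (t / ((m : ℝ) + 1)) = t := by field_simp
  refine le_trans (measure_mono fun z hz => ?_) (volume_shell_diff_iterGood_le hε hm hV0 hδ m)
  refine ⟨⟨hz.1, hz.2.1⟩, fun hzm => hz.2.2 ?_⟩
  have h := fwdGoodUpTo_of_mem_iterGood hε hm hV0 hδ m hzm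
  rwa [hT] at h

/-- **Forward regularity holds almost everywhere on the domain.** [cite: GST2013, Prop. 4.1.1 p. 19] -/
theorem volume_not_fwdGood_eq_zero (hε : 0 < ε) (hε' : ε < 2⁻¹) :
    volume {z : Config N d (UnitAddTorus d) | z ∈ hardSphereDomain (Torus.geometry d) N ε ∧
      ¬ FwdGood (Torus.geometry d) ε z} = 0 := by
  have hcov : {z : Config N d (UnitAddTorus d) | z ∈ hardSphereDomain (Torus.geometry d) N ε ∧
      ¬ FwdGood (Torus.geometry d) ε z} ⊆ ⋃ T : ℕ, ⋃ V : ℕ,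
        {z | z ∈ hardSphereDomain (Torus.geometry d) N ε ∧ configEnergy z ≤ (V : ℝ) ^ 2 / 2 ∧
          ¬ FwdGoodUpTo (Torus.geometry d) ε ((T : ℝ) + 1) z} := by
    rintro z ⟨hzD, hbad⟩
    rw [fwdGood_iff_forall_fwdGoodUpTo] at hbad
    push Not at hbad
    obtain ⟨T, hT⟩ := hbad
    obtain ⟨V, hV⟩ := exists_nat_ge (max 1 (2 * configEnergy z))
    refine mem_iUnion.2 ⟨T, mem_iUnion.2 ⟨V, hzD, ?_, fun h => hT (h.mono (by linarith))⟩⟩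
    have hV1 : (1 : ℝ) ≤ V := le_trans (le_max_left _ _) hV
    have hV2 : 2 * configEnergy z ≤ V := le_trans (le_max_right _ _) hV
    nlinarith
  refine measure_mono_null hcov (measure_iUnion_null fun T => measure_iUnion_null fun V => ?_)
  exact volume_not_fwdGoodUpTo_eq_zero hε hε' (Nat.cast_nonneg V) (by positivity)

/-- **Discharge of `torusFlow_ae_good` — Alexander's theorem on `T^d`**: for `0 < ε < 1/2`
the complement of the good set `Γ₀` of the collision-by-collision hard-sphere flow is
Liouville-null (Alexander 1975; CIP 1994 Thm. 4.2.1 with App. 4.A; GST 2013 Prop. 4.1.1).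
The bad data of the domain are: data with a pair in contact (null, `volume_contactSet`), data
that are not forward regular (null, `volume_not_fwdGood_eq_zero`), and data whose velocity
flip is not forward regular (null by `measurePreserving_flipVel`). [cite: GST2013, Prop. 4.1.1 p. 19] -/
theorem torusFlow_ae_good_holds : torusFlow_ae_good (d := d) := by
  intro ε hε hε' N
  have hG := Torus.isHardSphereRegular_geometry (d := d) hε'
  have hGm : (Torus.geometry d).IsMeasurable := Torus.isMeasurable_geometry
  have hD : MeasurableSet (hardSphereDomain (Torus.geometry d) N ε) :=
    measurableSet_hardSphereDomain _ Torus.measurable_geometry_sepVec N ε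
  -- the three null sets
  set Sf : Set (Config N d (UnitAddTorus d)) := {z | z ∈ hardSphereDomain (Torus.geometry d) N ε ∧
    ¬ FwdGood (Torus.geometry d) ε z} with hSf
  have hSfm : MeasurableSet Sf := hD.inter (measurableSet_fwdGood hG hGm).compl
  have hSf0 : volume Sf = 0 := volume_not_fwdGood_eq_zero hε hε'
  have hflip0 : volume (flipVel ⁻¹' Sf) = 0 := by
    rw [(measurePreserving_flipVel (X := UnitAddTorus d) (N := N) (d := d)).measure_preimage
      hSfm.nullMeasurableSet]
    exact hSf0
  have hcontact0 : volume (⋃ p : Fin N × Fin N, {z : Config N d (UnitAddTorus d) | p.1 ≠ p.2 ∧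
      z ∈ contactSet (Torus.geometry d) N ε p.1 p.2}) = 0 := by
    refine measure_iUnion_null fun p => ?_
    by_cases hp : p.1 = p.2
    · convert measure_empty (μ := (volume : Measure (Config N d (UnitAddTorus d))))
      ext z; simp [hp]
    · have : {z : Config N d (UnitAddTorus d) | p.1 ≠ p.2 ∧
          z ∈ contactSet (Torus.geometry d) N ε p.1 p.2} = contactSet (Torus.geometry d) N ε p.1 p.2 := by
        ext z; simp [hp]
      rw [this]
      exact volume_contactSet hε.ne' hp
  -- the bad data of the domain are covered by them
  have hcov : hardSphereDomain (Torus.geometry d) N ε \ good (Torus.geometry d) ε ⊆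
      (⋃ p : Fin N × Fin N, {z : Config N d (UnitAddTorus d) | p.1 ≠ p.2 ∧
        z ∈ contactSet (Torus.geometry d) N ε p.1 p.2}) ∪ Sf ∪ flipVel ⁻¹' Sf := by
    rintro z ⟨hzD, hzg⟩
    simp only [good, mem_setOf_eq, not_and] at hzg
    by_cases hc : ∃ i j : Fin N, i ≠ j ∧ z ∈ contactSet (Torus.geometry d) N ε i j
    · obtain ⟨i, j, hij, hcz⟩ := hc
      exact Or.inl (Or.inl (mem_iUnion.2 ⟨(i, j), hij, hcz⟩))
    push Not at hc
    by_cases hf : FwdGood (Torus.geometry d) ε z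
    · have hb : ¬ FwdGood (Torus.geometry d) ε (flipVel z) :=
        hzg hzD (fun i j hij hcz => absurd hcz (hc i j hij)) hf
      exact Or.inr ⟨(flipVel_mem_hardSphereDomain_iff z).2 hzD, hb⟩
    · exact Or.inl (Or.inr ⟨hzD, hf⟩)
  have hbad0 : volume (hardSphereDomain (Torus.geometry d) N ε \ good (Torus.geometry d) ε) = 0 := by
    refine measure_mono_null hcov ?_
    refine measure_union_null (measure_union_null hcontact0 hSf0) hflip0
  rw [liouville_eq, Measure.restrict_apply (measurableSet_good hG hGm).compl]
  have hset : (good (Torus.geometry d) ε)ᶜ ∩ hardSphereDomain (Torus.geometry d) N ε =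
      hardSphereDomain (Torus.geometry d) N ε \ good (Torus.geometry d) ε := by
    ext z; constructor <;> rintro ⟨h1, h2⟩ <;> exact ⟨h2, h1⟩
  rw [hset]
  exact hbad0

end Iteration

/-! ## Liouville's theorem -/

section Liouville

variable {ε : ℝ}

/-- Cancellation in `ℝ≥0∞`: if `a ≤ c`, `b ≤ d` and `a + b = c + d < ∞` then `a = c`. [folklore] -/
theorem ennreal_eq_of_add_eq_add_of_le {a b c d' : ℝ≥0∞} (h1 : a ≤ c) (h2 : b ≤ d')
    (hsum : a + b = c + d') (hfin : c + d' ≠ ∞) : a = c := by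
  by_contra hne
  have hlt : a < c := lt_of_le_of_ne h1 hne
  have hb : b ≠ ∞ := ne_top_of_le_ne_top hfin (by rw [← hsum]; exact le_add_self)
  have := ENNReal.add_lt_add_of_lt_of_le hb hlt h2
  rw [hsum] at this
  exact lt_irrefl _ this

/-- **Sub-invariance on energy shells**: for `t ≥ 0` and measurable `B`,
`vol {z ∈ Γ₀ ∩ {E ≤ V²/2} | Φ_t z ∈ B} ≤ vol B` (the iteration with `δ = t/(m+1)`, `m → ∞`;
GST 2013, proof of Prop. 4.1.1). [cite: GST2013, proof of Prop. 4.1.1 p. 19] -/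
theorem volume_good_shell_inter_preimage_le (hε : 0 < ε) (hε' : ε < 2⁻¹) {V : ℝ} (hV0 : 0 ≤ V)
    {t : ℝ} (ht : 0 ≤ t) {B : Set (Config N d (UnitAddTorus d))} (hB : MeasurableSet B) :
    volume {z : Config N d (UnitAddTorus d) | z ∈ good (Torus.geometry d) ε ∧
      configEnergy z ≤ V ^ 2 / 2 ∧ fwdFlow (Torus.geometry d) ε z t ∈ B} ≤ volume B := by
  have hG := Torus.isHardSphereRegular_geometry (d := d) hε'
  rcases ht.eq_or_lt with h0 | htpos
  · refine measure_mono fun z hz => ?_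
    have h : fwdFlow (Torus.geometry d) ε z 0 = z :=
      fwdFlow_zero_of_pos (freeExitTime_pos_of_mem_good hG hz.1)
    have h2 := hz.2.2
    rwa [← h0, h] at h2
  · have hlim : Tendsto (fun m : ℕ => volume B +
        ((m : ℝ≥0∞) + 1) * windowLoss (d := d) N (t / ((m : ℝ) + 1)) V) atTop (𝓝 (volume B)) := by
      have h := (tendsto_const_nhds : Tendsto (fun _ : ℕ => volume B) atTop (𝓝 (volume B))).add
        (tendsto_windowLoss (d := d) (N := N) hV0 ht)
      rwa [add_zero] at h
    refine ge_of_tendsto hlim ?_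
    filter_upwards [eventually_chart hε' V t] with m hm
    have hδ : 0 ≤ t / ((m : ℝ) + 1) := by positivity
    have hT : ((m : ℝ) + 1) * (t / ((m : ℝ) + 1)) = t := by field_simp
    calc volume {z : Config N d (UnitAddTorus d) | z ∈ good (Torus.geometry d) ε ∧
          configEnergy z ≤ V ^ 2 / 2 ∧ fwdFlow (Torus.geometry d) ε z t ∈ B}
        ≤ volume ({z | z ∈ iterGood N ε (t / ((m : ℝ) + 1)) V m ∧
            fwdFlow (Torus.geometry d) ε z (((m : ℝ) + 1) * (t / ((m : ℝ) + 1))) ∈ B} ∪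
            ({z : Config N d (UnitAddTorus d) | z ∈ hardSphereDomain (Torus.geometry d) N ε ∧
              configEnergy z ≤ V ^ 2 / 2} \ iterGood N ε (t / ((m : ℝ) + 1)) V m)) := by
          refine measure_mono fun z hz => ?_
          by_cases hzm : z ∈ iterGood N ε (t / ((m : ℝ) + 1)) V m
          · exact Or.inl ⟨hzm, by rw [hT]; exact hz.2.2⟩
          · exact Or.inr ⟨⟨good_subset_hardSphereDomain hz.1, hz.2.1⟩, hzm⟩
      _ ≤ volume B + ((m : ℝ≥0∞) + 1) * windowLoss (d := d) N (t / ((m : ℝ) + 1)) V :=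
          (measure_union_le _ _).trans (add_le_add
            (volume_iterGood_inter_preimage_le hε hm hV0 hδ m hB)
            (volume_shell_diff_iterGood_le hε hm hV0 hδ m))

/-- **Invariance on energy shells** (`t ≥ 0`): `vol(S_V ∩ Φ_t⁻¹ B) = vol(S_V ∩ B)` for
`S_V = Γ₀ ∩ {E ≤ V²/2}`, an invariant set of finite volume, by sub-invariance for `B` and its
complement. [cite: CIP1994, App. 4.A pp. 107–111] -/
theorem volume_good_shell_inter_preimage_eq (hε : 0 < ε) (hε' : ε < 2⁻¹) {V : ℝ} (hV0 : 0 ≤ V)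
    {t : ℝ} (ht : 0 ≤ t) {B : Set (Config N d (UnitAddTorus d))} (hB : MeasurableSet B) :
    volume ({z : Config N d (UnitAddTorus d) | z ∈ good (Torus.geometry d) ε ∧
        configEnergy z ≤ V ^ 2 / 2} ∩ (fun z => fwdFlow (Torus.geometry d) ε z t) ⁻¹' B) =
      volume ({z : Config N d (UnitAddTorus d) | z ∈ good (Torus.geometry d) ε ∧
        configEnergy z ≤ V ^ 2 / 2} ∩ B) := by
  have hG := Torus.isHardSphereRegular_geometry (d := d) hε'
  have hGm : (Torus.geometry d).IsMeasurable := Torus.isMeasurable_geometry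
  set S : Set (Config N d (UnitAddTorus d)) := {z | z ∈ good (Torus.geometry d) ε ∧
    configEnergy z ≤ V ^ 2 / 2} with hS
  set T : Config N d (UnitAddTorus d) → Config N d (UnitAddTorus d) :=
    fun z => fwdFlow (Torus.geometry d) ε z t with hT
  have hSm : MeasurableSet S := (measurableSet_good hG hGm).inter (measurableSet_energyShell _)
  have hmaps : MapsTo T S S := by
    intro z hz
    refine ⟨?_, ?_⟩
    · have h := mapsTo_flow_good hG t hz.1
      rwa [flow_of_nonneg ht] at h
    · show configEnergy (fwdFlow (Torus.geometry d) ε z t) ≤ V ^ 2 / 2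
      rw [configEnergy_fwdFlow]; exact hz.2
  have hfin : volume S ≠ ∞ := by
    have hsub : S ⊆ velBall N d (UnitAddTorus d) V := fun z hz =>
      setOf_configEnergy_le_subset_velBall hV0 hz.2
    refine ((measure_mono hsub).trans_lt ?_).ne
    rw [volume_velBall]
    exact ENNReal.pow_lt_top measure_closedBall_lt_top
  have hle : ∀ C : Set (Config N d (UnitAddTorus d)), MeasurableSet C →
      volume (S ∩ T ⁻¹' C) ≤ volume C := by
    intro C hC
    have h := volume_good_shell_inter_preimage_le hε hε' hV0 ht hC
    have hset : S ∩ T ⁻¹' C = {z : Config N d (UnitAddTorus d) | z ∈ good (Torus.geometry d) ε ∧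
        configEnergy z ≤ V ^ 2 / 2 ∧ fwdFlow (Torus.geometry d) ε z t ∈ C} := by
      ext z; simp only [hS, hT, mem_inter_iff, mem_setOf_eq, mem_preimage, and_assoc]
    rw [hset]; exact h
  have h1 : volume (S ∩ T ⁻¹' (S ∩ B)) ≤ volume (S ∩ B) := hle _ (hSm.inter hB)
  have h2 : volume (S ∩ T ⁻¹' (S \ B)) ≤ volume (S \ B) := hle _ (hSm.diff hB)
  have hsum : volume (S ∩ T ⁻¹' (S ∩ B)) + volume (S ∩ T ⁻¹' (S \ B)) = volume S := by
    have hTm : Measurable T := measurable_fwdFlow hG hGm t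
    have e1 : S ∩ T ⁻¹' (S ∩ B) = S ∩ T ⁻¹' S ∩ T ⁻¹' B := by
      ext z; simp only [mem_inter_iff, mem_preimage]; tauto
    have e2 : S ∩ T ⁻¹' (S \ B) = (S ∩ T ⁻¹' S) \ T ⁻¹' B := by
      ext z; simp only [mem_inter_iff, mem_preimage, Set.mem_sdiff]; tauto
    have e3 : S ∩ T ⁻¹' S = S := by
      ext z; simp only [mem_inter_iff, mem_preimage, and_iff_left_iff_imp]; exact fun hz => hmaps hz
    rw [e1, e2, measure_inter_add_sdiff _ (hTm hB), e3]
  have hsum' : volume (S ∩ B) + volume (S \ B) = volume S := measure_inter_add_sdiff S hB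
  have heq : volume (S ∩ T ⁻¹' (S ∩ B)) = volume (S ∩ B) :=
    ennreal_eq_of_add_eq_add_of_le h1 h2 (hsum.trans hsum'.symm) (by rw [hsum']; exact hfin)
  have hset : S ∩ T ⁻¹' B = S ∩ T ⁻¹' (S ∩ B) := by
    ext z
    simp only [mem_inter_iff, mem_preimage]
    exact ⟨fun h => ⟨h.1, hmaps h.1, h.2⟩, fun h => ⟨h.1, h.2.2⟩⟩
  rw [hset, heq]

/-- **Invariance of `vol|_{Γ₀}` under `Φ_t`, `t ≥ 0`** (exhaustion by energy shells). [cite: CIP1994, App. 4.A pp. 107–111] -/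
theorem volume_good_inter_preimage_fwdFlow_eq (hε : 0 < ε) (hε' : ε < 2⁻¹) {t : ℝ} (ht : 0 ≤ t)
    {B : Set (Config N d (UnitAddTorus d))} (hB : MeasurableSet B) :
    volume (good (Torus.geometry d) ε ∩ (fun z => fwdFlow (Torus.geometry d) ε z t) ⁻¹' B) =
      volume (good (N := N) (Torus.geometry d) ε ∩ B) := by
  have hS : ∀ X : Set (Config N d (UnitAddTorus d)), good (Torus.geometry d) ε ∩ X =
      ⋃ V : ℕ, ({z : Config N d (UnitAddTorus d) | z ∈ good (Torus.geometry d) ε ∧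
        configEnergy z ≤ (V : ℝ) ^ 2 / 2} ∩ X) := by
    intro X
    ext z
    simp only [mem_inter_iff, mem_iUnion, mem_setOf_eq]
    constructor
    · rintro ⟨hg, hx⟩
      obtain ⟨V, hV⟩ := exists_nat_ge (max 1 (2 * configEnergy z))
      have hV1 : (1 : ℝ) ≤ V := le_trans (le_max_left _ _) hV
      have hV2 : 2 * configEnergy z ≤ V := le_trans (le_max_right _ _) hV
      exact ⟨V, ⟨hg, by nlinarith⟩, hx⟩
    · rintro ⟨V, ⟨hg, -⟩, hx⟩
      exact ⟨hg, hx⟩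
  have hmono : ∀ X : Set (Config N d (UnitAddTorus d)), Monotone fun V : ℕ =>
      ({z : Config N d (UnitAddTorus d) | z ∈ good (Torus.geometry d) ε ∧
        configEnergy z ≤ (V : ℝ) ^ 2 / 2} ∩ X) := by
    intro X a b hab z hz
    refine ⟨⟨hz.1.1, hz.1.2.trans ?_⟩, hz.2⟩
    have : (a : ℝ) ≤ b := Nat.cast_le.2 hab
    have ha : (0 : ℝ) ≤ a := Nat.cast_nonneg a
    nlinarith
  rw [hS, hS B, (hmono _).measure_iUnion, (hmono _).measure_iUnion]
  exact iSup_congr fun V => volume_good_shell_inter_preimage_eq hε hε' (Nat.cast_nonneg V) ht hB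

/-- **Invariance of `vol|_{Γ₀}` under `T^t` for all `t`**: for `t < 0`, `T^t` is the inverse of
`T^{-t}` on `Γ₀` (group property, `HardSphereFlowGroup`). [cite: CIP1994, §4.2 (2.3)] -/
theorem volume_good_inter_preimage_flow_eq (hε : 0 < ε) (hε' : ε < 2⁻¹) (t : ℝ)
    {B : Set (Config N d (UnitAddTorus d))} (hB : MeasurableSet B) :
    volume (good (Torus.geometry d) ε ∩ flow (Torus.geometry d) ε t ⁻¹' B) =
      volume (good (N := N) (Torus.geometry d) ε ∩ B) := by
  have hG := Torus.isHardSphereRegular_geometry (d := d) hε'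
  have hGm : (Torus.geometry d).IsMeasurable := Torus.isMeasurable_geometry
  rcases le_or_gt 0 t with ht | ht
  · have hset : good (Torus.geometry d) ε ∩ flow (Torus.geometry d) ε t ⁻¹' B =
        good (N := N) (Torus.geometry d) ε ∩ (fun z => fwdFlow (Torus.geometry d) ε z t) ⁻¹' B := by
      ext z; simp only [mem_inter_iff, mem_preimage, flow_of_nonneg ht]
    rw [hset]
    exact volume_good_inter_preimage_fwdFlow_eq hε hε' ht hB
  · have hs : 0 ≤ -t := by linarith
    set A : Set (Config N d (UnitAddTorus d)) :=
      good (Torus.geometry d) ε ∩ flow (Torus.geometry d) ε t ⁻¹' B with hA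
    have hAm : MeasurableSet A := (measurableSet_good hG hGm).inter (measurable_flow hG hGm t hB)
    have key := volume_good_inter_preimage_fwdFlow_eq hε hε' hs hAm
    have hinv : ∀ z ∈ good (N := N) (Torus.geometry d) ε,
        flow (Torus.geometry d) ε t (flow (Torus.geometry d) ε (-t) z) = z := by
      intro z hz
      rw [← flow_add_of_mem_good hG t (-t) hz, add_neg_cancel, flow_zero_of_mem_good hG hz]
    have h1 : good (Torus.geometry d) ε ∩ (fun z => fwdFlow (Torus.geometry d) ε z (-t)) ⁻¹' A =
        good (Torus.geometry d) ε ∩ B := by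
      ext z
      simp only [hA, mem_inter_iff, mem_preimage, ← flow_of_nonneg hs]
      constructor
      · rintro ⟨hz, -, hzB⟩
        rw [hinv z hz] at hzB
        exact ⟨hz, hzB⟩
      · rintro ⟨hz, hzB⟩
        refine ⟨hz, mapsTo_flow_good hG (-t) hz, ?_⟩
        rw [hinv z hz]
        exact hzB
    have h2 : good (Torus.geometry d) ε ∩ A = A := inter_eq_right.2 inter_subset_left
    rw [h1, h2] at key
    exact key.symm

/-- **Discharge of `torusFlow_measurePreserving` — Liouville's theorem for the hard-sphere flow
on `T^d`**: for `0 < ε < 1/2` each `T^t` preserves the Liouville measure `dZ|_{D_ε^N}`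
(CIP 1994 §4.2 and App. 4.A; GST 2013, proof of Prop. 4.1.1: "the measure is invariant by the
flow"). Since `Γ₀ᶜ` is null (`torusFlow_ae_good_holds`), `liouville = vol|_{Γ₀}`, which is
invariant by `volume_good_inter_preimage_flow_eq`. [cite: CIP1994, App. 4.A pp. 107–111] -/
theorem torusFlow_measurePreserving_holds : torusFlow_measurePreserving (d := d) := by
  intro ε hε hε' N t
  have hG := Torus.isHardSphereRegular_geometry (d := d) hε'
  have hGm : (Torus.geometry d).IsMeasurable := Torus.isMeasurable_geometry
  have hgood : MeasurableSet (good (N := N) (Torus.geometry d) ε) := measurableSet_good hG hGm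
  have hae : hardSphereDomain (Torus.geometry d) N ε =ᵐ[volume] good (Torus.geometry d) ε := by
    rw [ae_eq_set]
    refine ⟨?_, ?_⟩
    · have h := torusFlow_ae_good_holds (d := d) hε hε' N
      rw [liouville_eq, Measure.restrict_apply hgood.compl] at h
      have hset : (good (Torus.geometry d) ε)ᶜ ∩ hardSphereDomain (Torus.geometry d) N ε =
          hardSphereDomain (Torus.geometry d) N ε \ good (Torus.geometry d) ε := by
        ext z; constructor <;> rintro ⟨h1, h2⟩ <;> exact ⟨h2, h1⟩
      rwa [hset] at h
    · exact measure_mono_null (fun z hz => (hz.2 (good_subset_hardSphereDomain hz.1)).elim)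
        measure_empty
  have hL : liouville (Torus.geometry d) N ε = volume.restrict (good (Torus.geometry d) ε) := by
    rw [liouville_eq]; exact Measure.restrict_congr_set hae
  refine ⟨measurable_flow hG hGm t, ?_⟩
  rw [hL]
  ext B hB
  rw [Measure.map_apply (measurable_flow hG hGm t) hB,
    Measure.restrict_apply (measurable_flow hG hGm t hB), Measure.restrict_apply hB, inter_comm,
    volume_good_inter_preimage_flow_eq hε hε' t hB, inter_comm]

end Liouville

end Alexander

/-! ## Alexander's theorem on the torus -/

variable {d : Type*} [Fintype d]

/-- **Alexander's theorem on the flat torus `T^d`** — discharge of the named fact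
`Kinetic.HardSphereFlow.nonempty_torus` (Alexander 1975; Gallagher–Saint-Raymond–Texier 2013
Prop. 4.1.1; Cercignani–Illner–Pulvirenti 1994 Thm. 4.2.1, App. 4.A): for `0 < ε < 1/2` and
every `N` the hard-sphere flow on `(T^d × ℝ^d)^N` exists — the collision-by-collision flow
`Kinetic.Alexander.flow` with good set `Kinetic.Alexander.good` is a measurable group of
hard-sphere trajectories on an invariant Liouville-conull set and preserves the Liouville
measure (`HardSphereFlow.nonempty_torus_of_construction` fed with the five discharged facts
`torusFlow_group_holds`, `torusFlow_isTrajectory_holds`, `torusFlow_measurable_holds`,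
`torusFlow_ae_good_holds`, `torusFlow_measurePreserving_holds`). [cite: Alexander1975] [cite: GST2013, Prop. 4.1.1 p. 19] -/
theorem HardSphereFlow.nonempty_torus_holds : HardSphereFlow.nonempty_torus (d := d) :=
  HardSphereFlow.nonempty_torus_of_construction Alexander.torusFlow_group_holds
    Alexander.torusFlow_isTrajectory_holds Alexander.torusFlow_measurable_holds
    Alexander.torusFlow_ae_good_holds Alexander.torusFlow_measurePreserving_holds

end Kinetic

end

end Literature.Analysis.FluidPDE
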